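import Literature.AlgebraicGeometry.Resolution.ArithmeticalThreefoldsLocalDescentEquivariantSplit
import HarnessLib

/-!
# Cossart–Piltant 2019, (C4): the single equivariant local uniformization implies its two minimal forms

Topic: `Literature/AlgebraicGeometry/Resolution`. PROOF side of `CossartPiltant2019ReductionP`
(`ArithmeticalThreefoldsLocal.lean`), input (C4). Bookkeeping between the two keyed chains
`cossartPiltant2019ReductionP_of_printed_of_equivariantLU` (hypothesis `hEq`: equivariant
local uniformization with cofinality for every tamely acting group,
`ArithmeticalThreefoldsLocalDescentEquivariant.lean`) and
`cossartPiltant2019ReductionP_of_printed_of_equivariantLU_split` (hypotheses `hEqT`, Kummer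
type, and `hEqI`, inertia type, `ArithmeticalThreefoldsLocalDescentEquivariantSplit.lean`):
`hEq` implies `hEqT` (take `s₀ = ∅`; the extra premises of `hEqT` are not used) and `hEqI`
(take `s₀ = {x₀}`; an element moving a unit `x` by a unit moves `x ≠ 0` by exactly `v(x)`)
— `equivariantLU_split_of_equivariantLU` — so the split chain is the sharper one and the
single-hypothesis chain factors through it (the one-liner
`cossartPiltant2019ReductionP_of_printed_of_equivariantLU_split hloc h44 hCJS hCJSE
(equivariantLU_split_of_equivariantLU hEq).1 (equivariantLU_split_of_equivariantLU hEq).2`,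
which restates the landed `cossartPiltant2019ReductionP_of_printed_of_equivariantLU` and is
therefore not repeated here).

Everything is PROVED; no named facts, definitions, instances or notation are introduced.

## Sources

* V. Cossart, O. Piltant, J. Algebra 529 (2019) 268–535 = arXiv:1412.0868: proof of Prop. 4.10
  (arXiv v1: Prop. 4.8, pp. 53–54). [CossartPiltant2019]
* V. Cossart, O. Piltant, J. Algebra 320 (2008) 1051–1082: Prop. 9.3, Lemma 9.4 (HAL
  hal-00139124, pp. 26–30). [CossartPiltant2008]
-/

noncomputable section

open CategoryTheory AlgebraicGeometry TopologicalSpace IsLocalRing _root_.Polynomial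
  _root_.IntermediateField

namespace Literature.AlgebraicGeometry.Resolution

universe u

set_option maxHeartbeats 1600000 in
/-- **`hEq ⇒ hEqT ∧ hEqI`**: equivariant local uniformization with cofinality for all tamely
acting groups gives the Kummer-type form (take `s₀ = ∅`; the extra premises are not used) and
the inertia-type form (take `s₀ = {x₀}`; a unit moved by a unit is a non-zero element moved by
exactly its value). [cite: CossartPiltant2008, Lemma 9.4 and its proof (HAL p. 29)]
[cite: CossartPiltant2019, proof of Prop. 4.10 (arXiv v1: Prop. 4.8, p. 54)] -/
theorem equivariantLU_split_of_equivariantLU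
    (hEq :
      ∀ (p : ℕ), p.Prime →
      ∀ (S : Type u) [CommRing S] [IsDomain S] [IsRegularLocalRing S],
        IsExcellentRing S → ringKrullDim S = 3 → CharP (ResidueField S) p →
        IsAdicComplete (maximalIdeal S) S →
      ∀ (E : Type u) [Field E] [Algebra S E], Function.Injective (algebraMap S E) →
        IsAlgClosed E → Algebra.IsAlgebraic S E →
      ∀ (OE : ValuationSubring E), (∀ s : S, algebraMap S E s ∈ OE) →
        (∀ s ∈ maximalIdeal S, OE.valuation (algebraMap S E s) < 1) →
        (∀ y : OE, ∃ q : S[X], (∃ i, q.coeff i ∉ maximalIdeal S) ∧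
          OE.valuation (q.eval₂ (algebraMap S E) y) < 1) →
      Nonempty OE.valuation.RankOne →
      ∀ (M' : Subfield E), (∀ s : S, algebraMap S E s ∈ M') →
      ∀ (H : Subgroup (E ≃ₐ[S] E)),
        (∀ σ ∈ H, ∀ x ∈ M', σ x ∈ M') →
        (∀ σ ∈ H, ∀ x ∈ M', x ∈ OE → σ x ∈ OE) →
        (∀ σ ∈ H, (∃ x ∈ M', σ x ≠ x) →
          ∃ x ∈ M', x ≠ 0 ∧ OE.valuation (σ x - x) = OE.valuation x) →
      ∀ (s₀ : Finset E), (s₀ : Set E) ⊆ M' → (∀ x ∈ s₀, x ∈ OE) →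
        (∃ t : Finset E, (t : Set E) ⊆ M' ∧
          M' ≤ Subfield.closure (Set.range (algebraMap S E) ∪ (t : Set E)) ∧
          ∃ hTO : (Algebra.adjoin S (t : Set E)).toSubring ≤ OE.toSubring,
            IsRegularLocalRing (Localization.AtPrime
              (Ideal.comap (Subring.inclusion hTO) (maximalIdeal OE)))) →
        ∃ t : Finset E, (t : Set E) ⊆ M' ∧
          M' ≤ Subfield.closure (Set.range (algebraMap S E) ∪ (t : Set E)) ∧
          ∃ hTO : (Algebra.adjoin S (t : Set E)).toSubring ≤ OE.toSubring,
            IsRegularLocalRing (Localization.AtPrime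
              (Ideal.comap (Subring.inclusion hTO) (maximalIdeal OE))) ∧
            (∀ σ ∈ H, ∀ x ∈ locAtCentre (Algebra.adjoin S (t : Set E)).toSubring OE,
              σ x ∈ locAtCentre (Algebra.adjoin S (t : Set E)).toSubring OE) ∧
            (s₀ : Set E) ⊆ locAtCentre (Algebra.adjoin S (t : Set E)).toSubring OE) :
    (∀ (p : ℕ), p.Prime →
      ∀ (S : Type u) [CommRing S] [IsDomain S] [IsRegularLocalRing S],
        IsExcellentRing S → ringKrullDim S = 3 → CharP (ResidueField S) p →
        IsAdicComplete (maximalIdeal S) S →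
      ∀ (E : Type u) [Field E] [Algebra S E], Function.Injective (algebraMap S E) →
        IsAlgClosed E → Algebra.IsAlgebraic S E →
      ∀ (OE : ValuationSubring E), (∀ s : S, algebraMap S E s ∈ OE) →
        (∀ s ∈ maximalIdeal S, OE.valuation (algebraMap S E s) < 1) →
        (∀ y : OE, ∃ q : S[X], (∃ i, q.coeff i ∉ maximalIdeal S) ∧
          OE.valuation (q.eval₂ (algebraMap S E) y) < 1) →
      Nonempty OE.valuation.RankOne →
      ∀ (M' : Subfield E), (∀ s : S, algebraMap S E s ∈ M') →
      ∀ (H : Subgroup (E ≃ₐ[S] E)),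
        (∀ σ ∈ H, ∀ x ∈ M', σ x ∈ M') →
        (∀ σ ∈ H, ∀ x ∈ M', x ∈ OE → σ x ∈ OE) →
        (∀ σ ∈ H, ∀ x ∈ M', x ∈ OE → OE.valuation (σ x - x) < 1) →
        (∃ ℓ : ℕ, ℓ.Prime ∧ ℓ ≠ p ∧ ∀ σ ∈ H, ∀ x ∈ M', (σ ^ ℓ) x = x) →
        (∀ σ ∈ H, (∃ x ∈ M', σ x ≠ x) →
          ∃ x ∈ M', x ≠ 0 ∧ OE.valuation (σ x - x) = OE.valuation x) →
        (∃ t : Finset E, (t : Set E) ⊆ M' ∧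
          M' ≤ Subfield.closure (Set.range (algebraMap S E) ∪ (t : Set E)) ∧
          ∃ hTO : (Algebra.adjoin S (t : Set E)).toSubring ≤ OE.toSubring,
            IsRegularLocalRing (Localization.AtPrime
              (Ideal.comap (Subring.inclusion hTO) (maximalIdeal OE)))) →
        ∃ t : Finset E, (t : Set E) ⊆ M' ∧
          M' ≤ Subfield.closure (Set.range (algebraMap S E) ∪ (t : Set E)) ∧
          ∃ hTO : (Algebra.adjoin S (t : Set E)).toSubring ≤ OE.toSubring,
            IsRegularLocalRing (Localization.AtPrime
              (Ideal.comap (Subring.inclusion hTO) (maximalIdeal OE))) ∧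
            (∀ σ ∈ H, ∀ x ∈ locAtCentre (Algebra.adjoin S (t : Set E)).toSubring OE,
              σ x ∈ locAtCentre (Algebra.adjoin S (t : Set E)).toSubring OE)) ∧
    (∀ (p : ℕ), p.Prime →
      ∀ (S : Type u) [CommRing S] [IsDomain S] [IsRegularLocalRing S],
        IsExcellentRing S → ringKrullDim S = 3 → CharP (ResidueField S) p →
        IsAdicComplete (maximalIdeal S) S →
      ∀ (E : Type u) [Field E] [Algebra S E], Function.Injective (algebraMap S E) →
        IsAlgClosed E → Algebra.IsAlgebraic S E →
      ∀ (OE : ValuationSubring E), (∀ s : S, algebraMap S E s ∈ OE) →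
        (∀ s ∈ maximalIdeal S, OE.valuation (algebraMap S E s) < 1) →
        (∀ y : OE, ∃ q : S[X], (∃ i, q.coeff i ∉ maximalIdeal S) ∧
          OE.valuation (q.eval₂ (algebraMap S E) y) < 1) →
      Nonempty OE.valuation.RankOne →
      ∀ (M' : Subfield E), (∀ s : S, algebraMap S E s ∈ M') →
      ∀ (H : Subgroup (E ≃ₐ[S] E)),
        (∀ σ ∈ H, ∀ x ∈ M', σ x ∈ M') →
        (∀ σ ∈ H, ∀ x ∈ M', x ∈ OE → σ x ∈ OE) →
        (∀ σ ∈ H, (∃ x ∈ M', σ x ≠ x) →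
          ∃ x ∈ M', OE.valuation x = 1 ∧ OE.valuation (σ x - x) = 1) →
      ∀ (x₀ : E), x₀ ∈ M' → x₀ ∈ OE →
        (∃ t : Finset E, (t : Set E) ⊆ M' ∧
          M' ≤ Subfield.closure (Set.range (algebraMap S E) ∪ (t : Set E)) ∧
          ∃ hTO : (Algebra.adjoin S (t : Set E)).toSubring ≤ OE.toSubring,
            IsRegularLocalRing (Localization.AtPrime
              (Ideal.comap (Subring.inclusion hTO) (maximalIdeal OE)))) →
        ∃ t : Finset E, (t : Set E) ⊆ M' ∧
          M' ≤ Subfield.closure (Set.range (algebraMap S E) ∪ (t : Set E)) ∧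
          ∃ hTO : (Algebra.adjoin S (t : Set E)).toSubring ≤ OE.toSubring,
            IsRegularLocalRing (Localization.AtPrime
              (Ideal.comap (Subring.inclusion hTO) (maximalIdeal OE))) ∧
            (∀ σ ∈ H, ∀ x ∈ locAtCentre (Algebra.adjoin S (t : Set E)).toSubring OE,
              σ x ∈ locAtCentre (Algebra.adjoin S (t : Set E)).toSubring OE) ∧
            x₀ ∈ locAtCentre (Algebra.adjoin S (t : Set E)).toSubring OE) := by
  classical
  constructor
  · intro p hp S _ _ _ hSexc hSdim hSchar hScomp E _ _ hinj hE halg OE hSO hdom hres hrk M' hSM' H hH1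
      hH2 _ _ hH3 hLU
    obtain ⟨t, ht, hle, hTO, hreg, hstab, -⟩ := hEq p hp S hSexc hSdim hSchar hScomp E hinj hE halg OE
      hSO hdom hres hrk M' hSM' H hH1 hH2 hH3 ∅ (by simp) (by simp) hLU
    exact ⟨t, ht, hle, hTO, hreg, hstab⟩
  · intro p hp S _ _ _ hSexc hSdim hSchar hScomp E _ _ hinj hE halg OE hSO hdom hres hrk M' hSM' H hH1
      hH2 hH3 x₀ hx₀M hx₀O hLU
    have hH3' : ∀ σ ∈ H, (∃ x ∈ M', σ x ≠ x) →
        ∃ x ∈ M', x ≠ 0 ∧ OE.valuation (σ x - x) = OE.valuation x := by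
      intro σ hσ hmv
      obtain ⟨x, hxM, hvx, hvσ⟩ := hH3 σ hσ hmv
      refine ⟨x, hxM, fun h0 => ?_, by rw [hvσ, hvx]⟩
      rw [h0, map_zero] at hvx
      exact zero_ne_one hvx
    have hs₀ : ((({x₀} : Finset E)) : Set E) ⊆ M' := by
      rw [Finset.coe_singleton, Set.singleton_subset_iff]
      exact hx₀M
    have hs₀O : ∀ x ∈ ({x₀} : Finset E), x ∈ OE := by
      intro x hx
      rw [Finset.mem_singleton] at hx
      rw [hx]
      exact hx₀O
    obtain ⟨t, ht, hle, hTO, hreg, hstab, hx₀T⟩ := hEq p hp S hSexc hSdim hSchar hScomp E hinj hE halg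
      OE hSO hdom hres hrk M' hSM' H hH1 hH2 hH3' {x₀} hs₀ hs₀O hLU
    rw [Finset.coe_singleton, Set.singleton_subset_iff] at hx₀T
    exact ⟨t, ht, hle, hTO, hreg, hstab, hx₀T⟩

end Literature.AlgebraicGeometry.Resolution

end
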